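import Summits.QuantumAdvantage.QuantumAdvantage.Theorems.AnchorDialWindowDial

/-!
# AnchorDial — part 17/18 «SetTable» (cell decomp-qadv, seat lens-2, generation 14 rev 9; supports item 26531 `ExactnessDial.PolyLossOddU3`)

§12j of the node (rev 9), first half: MULTI-POINT WINDOW BETS ARE AVOID-VALUE CLAIMS.  Parity of exclusions
(`exCnt`, **`exCnt_sum`**: `Σ_{v ∈ 𝔽₃} #{q : v ≠ a_q} = 2·#S`) ⇒ the canonical excluded value **`thirdVal`** (even exclusion
count: `thirdVal_even`, `thirdVal_congr`; win ⟹ the phase avoids it for both hidden bits: `ne_third_false`, `ne_third_true`);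
window positions `winQ` (`card_winQ_le`), pattern indicators `patInd` (`patInd_mem`, `patInd_apply_self`, `patInd_apply_ne`),
the local excluded-value table `hTab` (`hTab_mem`, degree `≤ r`), the interpolated SET-WINDOW VALUE TABLE **`gS`** (`gS_mem`:
degree `(r+1)(2D+2) + r`; `gS_apply`), **`cwt_gS_of_rel`** (odd input, unique anchor `k`, deviation SET inside `[k, k+r]`, any
size: win ⟹ `CWT A (gS P r) x`), `deg_bump_set`.  Verbatim from the node file (rev 9); namespace `…Theorems.AnchorDial`;
imports part 16; joint check `tree/Tail12to18.check.lean` (parts 12–18 against the landed parts 1–11); record NODE-g14.md §REV 9.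
-/

set_option linter.dupNamespace false

noncomputable section

open scoped Classical

namespace Summit.QuantumAdvantage.QuantumAdvantage.Theorems.AnchorDial

open Finset
open Literature.Computability.QuantumComplexity Literature.Computability.QuantumComplexity.RingHLF
open Literature.Computability.MetaComplexity Literature.Computability.MetaComplexity.Smolensky
open Summit.QuantumAdvantage.AdviceFreeQNC0
open Summit.QuantumAdvantage.QuantumAdvantage.Theses (ExactnessDial.PolyLossOddU3 ExactnessDial.DPLift3)
open Summit.QuantumAdvantage.QuantumAdvantage.Theorems.HolonomyDial (gCond tPoly tPoly_mem tPoly_apply selP selP_mem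
  selP_apply xorP xorP_mem xorP_apply_bool closes_T)

variable {N : ℕ}

section SetTable


/-! ## §12j (rev 9) MULTI-POINT WINDOW BETS ARE AVOID-VALUE CLAIMS: the SET-WINDOW LAW `windowSet_loss`

A deviation SET `dev P x ⊆ [k, k+r]` — any number of points — wins iff an ODD number of its points `q` satisfy
`gCond x q`, i.e. `c_k(x) ≠ a_q^{(u)}(x)` (`gCond_window`).  PARITY OF EXCLUSIONS (`exCnt_sum`): for any values
`a_q ∈ 𝔽₃`, `Σ_{v ∈ 𝔽₃} #{q : v ≠ a_q} = 2·#dev` is even, so the set of kernel phases `v` that win has EVEN size and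
is never all of `𝔽₃`: the canonical value `e(x) = thirdVal` with an even exclusion count (a function of the VISIBLE
data only — the deviation pattern inside the window and the window bits) satisfies win ⟹ `c_k ≠ e^{(u)}` for BOTH
hidden bits (`v ↦ 1 - v` is a bijection: `ne_third_false`, `ne_third_true`).  Hence EVERY window bet, single- or
multi-point, is ONE avoid-value claim (`cwt_gS_of_rel`, with the interpolated polylog table `gS`), and
`value_certificate_loss` applies: the hypothesis UNI (one deviation point a.e.) of `windowDev_loss` is DROPPED
(`windowSet_loss`).  After rev 9 the ONLY escape from the laws is DELOCALISATION: deviation sets not confined, a.e.,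
to a bounded window over a declarable (polylog, a.e.-unique, flip-stable) coarse anchor (`NoSetAnchorLoss3 ≡ T`).
-/

/-- exclusion count: window positions `q ∈ S` whose value differs from `v`. -/
def exCnt (S : Finset (Fin N)) (w : Fin N → ZMod 3) (v : ZMod 3) : ℕ := (S.filter fun q => v ≠ w q).card

/-- PARITY OF EXCLUSIONS: `exCnt 0 + exCnt 1 + exCnt 2 = 2·#S`. -/
theorem exCnt_sum (S : Finset (Fin N)) (w : Fin N → ZMod 3) :
    exCnt S w 0 + exCnt S w 1 + exCnt S w 2 = 2 * S.card := by
  unfold exCnt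
  rw [card_filter, card_filter, card_filter, ← sum_add_distrib, ← sum_add_distrib, card_eq_sum_ones, mul_sum]
  refine sum_congr rfl fun q _ => ?_
  have key : ∀ t : ZMod 3, ((if (0 : ZMod 3) ≠ t then 1 else 0) + (if (1 : ZMod 3) ≠ t then 1 else 0) +
      (if (2 : ZMod 3) ≠ t then 1 else 0) : ℕ) = 2 * 1 := by decide
  exact key (w q)

/-- the canonical EXCLUDED VALUE: the least `v ∈ 𝔽₃` with an even exclusion count. -/
def thirdVal (S : Finset (Fin N)) (w : Fin N → ZMod 3) : ZMod 3 :=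
  if exCnt S w 0 % 2 = 0 then 0 else if exCnt S w 1 % 2 = 0 then 1 else 2

/-- AnchorDialSetTable helper `thirdVal_even` (decomp-qadv land package; see the module docstring). -/
theorem thirdVal_even (S : Finset (Fin N)) (w : Fin N → ZMod 3) : exCnt S w (thirdVal S w) % 2 = 0 := by
  unfold thirdVal
  by_cases h0 : exCnt S w 0 % 2 = 0
  · rw [if_pos h0]; exact h0
  rw [if_neg h0]
  by_cases h1 : exCnt S w 1 % 2 = 0
  · rw [if_pos h1]; exact h1
  rw [if_neg h1]
  have := exCnt_sum S w
  omega

/-- AnchorDialSetTable helper `thirdVal_congr` (decomp-qadv land package; see the module docstring). -/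
theorem thirdVal_congr (S : Finset (Fin N)) {w w' : Fin N → ZMod 3} (h : ∀ q ∈ S, w q = w' q) :
    thirdVal S w = thirdVal S w' := by
  have e : ∀ v, exCnt S w v = exCnt S w' v := fun v => by
    unfold exCnt
    exact congrArg Finset.card (filter_congr fun q hq => by rw [h q hq])
  unfold thirdVal
  rw [e 0, e 1]

/-- win under hidden bit `u = 0` ⟹ the phase is not the excluded value. -/
theorem ne_third_false (S : Finset (Fin N)) (w : Fin N → ZMod 3) (cv : ZMod 3)
    (hodd : (S.filter fun q => cv ≠ w q).card % 2 = 1) : cv ≠ thirdVal S w := by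
  intro hc
  rw [hc] at hodd
  have h := thirdVal_even S w
  unfold exCnt at h
  omega

/-- win under hidden bit `u = 1` (all values reflected `a ↦ 1 - a`) ⟹ the phase is not the REFLECTED excluded value. -/
theorem ne_third_true (S : Finset (Fin N)) (w : Fin N → ZMod 3) (cv : ZMod 3)
    (hodd : (S.filter fun q => cv ≠ 1 - w q).card % 2 = 1) : cv ≠ 1 - thirdVal S w := by
  intro hc
  rw [hc] at hodd
  have e : (S.filter fun q => (1 - thirdVal S w) ≠ 1 - w q) = S.filter fun q => thirdVal S w ≠ w q :=
    filter_congr fun q _ => by rw [Ne, Ne, sub_right_inj]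
  rw [e] at hodd
  have h := thirdVal_even S w
  unfold exCnt at h
  omega

/-- the window positions `[k, k + r]`. -/
def winQ (r : ℕ) (k : Fin N) : Finset (Fin N) := univ.filter fun q => k.val ≤ q.val ∧ q.val ≤ k.val + r

/-- AnchorDialSetTable helper `card_winQ_le` (decomp-qadv land package; see the module docstring). -/
theorem card_winQ_le (r : ℕ) (k : Fin N) : (winQ r k).card ≤ r + 1 := by
  have hsub : (winQ r k).map Fin.valEmbedding ⊆ Finset.Icc k.val (k.val + r) := by
    intro m hm
    rw [Finset.mem_map] at hm
    obtain ⟨q, hq, rfl⟩ := hm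
    rw [winQ, mem_filter] at hq
    rw [Finset.mem_Icc]
    exact hq.2
  have h := Finset.card_le_card hsub
  rw [Finset.card_map, Nat.card_Icc] at h
  omega

/-- PATTERN INDICATOR of a sub-pattern `S` of the window: `Π_{q ∈ window} (q ∈ S ? [q ∈ dev] : [q ∉ dev])`. -/
def patInd (P : Fin N → CubeFn (ZMod 3) N) (r : ℕ) (k : Fin N) (S : Finset (Fin N)) : CubeFn (ZMod 3) N :=
  ∏ q ∈ winQ r k, (if q ∈ S then devA P q else 1 - devA P q)

/-- AnchorDialSetTable helper `patInd_mem` (decomp-qadv land package; see the module docstring). -/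
theorem patInd_mem {D : ℕ} {P : Fin N → CubeFn (ZMod 3) N} (hP : ∀ i, P i ∈ lowDeg (ZMod 3) N D) (r : ℕ)
    (k : Fin N) (S : Finset (Fin N)) : patInd P r k S ∈ lowDeg (ZMod 3) N ((r + 1) * ((D + D) + 2)) := by
  unfold patInd
  refine lowDeg_mono (Nat.mul_le_mul_right _ (card_winQ_le r k)) (prod_mem_lowDeg _ fun q _ => ?_)
  by_cases hq : q ∈ S
  · rw [if_pos hq]; exact devA_mem hP q
  · rw [if_neg hq]; exact Submodule.sub_mem _ (one_mem_lowDeg _) (devA_mem hP q)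

/-- AnchorDialSetTable helper `patInd_apply_self` (decomp-qadv land package; see the module docstring). -/
theorem patInd_apply_self (P : Fin N → CubeFn (ZMod 3) N) (r : ℕ) (k : Fin N) (x : Fin N → Bool) :
    patInd P r k (dev P x) x = 1 := by
  unfold patInd
  rw [Finset.prod_apply]
  refine Finset.prod_eq_one fun q _ => ?_
  by_cases hqd : q ∈ dev P x
  · rw [if_pos hqd, devA_apply, if_pos hqd]
  · rw [if_neg hqd, Pi.sub_apply, Pi.one_apply, devA_apply, if_neg hqd, sub_zero]

/-- AnchorDialSetTable helper `patInd_apply_ne` (decomp-qadv land package; see the module docstring). -/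
theorem patInd_apply_ne (P : Fin N → CubeFn (ZMod 3) N) (r : ℕ) (k : Fin N) (x : Fin N → Bool)
    (S : Finset (Fin N)) (hS : S ⊆ winQ r k) (hdev : dev P x ⊆ winQ r k) (hne : S ≠ dev P x) :
    patInd P r k S x = 0 := by
  have hex : ∃ q ∈ winQ r k, ¬ (q ∈ S ↔ q ∈ dev P x) := by
    by_contra h
    push Not at h
    exact hne (Finset.ext fun q =>
      ⟨fun hq => (h q (hS hq)).1 hq, fun hq => (h q (hdev hq)).2 hq⟩)
  obtain ⟨q, hqW, hq⟩ := hex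
  unfold patInd
  rw [Finset.prod_apply]
  refine Finset.prod_eq_zero hqW ?_
  by_cases hqS : q ∈ S
  · have hqd : q ∉ dev P x := fun h => hq ⟨fun _ => h, fun _ => hqS⟩
    rw [if_pos hqS, devA_apply, if_neg hqd]
  · have hqd : q ∈ dev P x := by
      by_contra h
      exact hq ⟨fun h' => absurd h' hqS, fun h' => absurd h' h⟩
    rw [if_neg hqS, Pi.sub_apply, Pi.one_apply, devA_apply, if_pos hqd, sub_self]

/-- the EXCLUDED-VALUE TABLE of pattern `S` over anchor `k` — a LOCAL function of the window bits. -/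
def hTab (k : Fin N) (S : Finset (Fin N)) : CubeFn (ZMod 3) N :=
  fun x => thirdVal S (fun q => wval x k.val (q.val - k.val))

/-- AnchorDialSetTable helper `hTab_mem` (decomp-qadv land package; see the module docstring). -/
theorem hTab_mem (r : ℕ) (k : Fin N) (S : Finset (Fin N)) (hS : S ⊆ winQ r k) :
    hTab k S ∈ lowDeg (ZMod 3) N r := by
  set T := (univ : Finset (Fin N)).filter fun i => k.val + 1 ≤ i.val ∧ i.val < k.val + r with hT
  have hcard : T.card ≤ r := by
    have hsub : T.map Fin.valEmbedding ⊆ Finset.Ico (k.val + 1) (k.val + 1 + r) := by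
      intro m hm
      rw [Finset.mem_map] at hm
      obtain ⟨q, hq, rfl⟩ := hm
      rw [hT, mem_filter] at hq
      rw [Finset.mem_Ico]
      constructor
      · exact hq.2.1
      · have := hq.2.2
        show q.val < k.val + 1 + r
        omega
    have h := Finset.card_le_card hsub
    rw [Finset.card_map, Nat.card_Ico] at h
    omega
  refine lowDeg_mono hcard (mem_lowDeg_of_dependsOn3 T
    (fun x => thirdVal S fun q => wval x k.val (q.val - k.val)) ?_)
  intro u v huv
  refine thirdVal_congr S fun q hq => ?_
  have hqw := hS hq
  rw [winQ, mem_filter] at hqw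
  have hqN := q.isLt
  show wval u k.val (q.val - k.val) = wval v k.val (q.val - k.val)
  unfold wval
  rw [wcnt_local k.val (q.val - k.val) (by omega) u v (fun i h1 h2 => huv i (by
    rw [hT, mem_filter]; exact ⟨mem_univ _, h1, by omega⟩))]

/-- the SET-WINDOW VALUE TABLE over anchor `k`: `Σ_{S ⊆ window} patInd_S · hTab_S`
(multilinear interpolation over the `2^{r+1}` deviation patterns). -/
def gS (P : Fin N → CubeFn (ZMod 3) N) (r : ℕ) (k : Fin N) : CubeFn (ZMod 3) N :=
  ∑ S ∈ (winQ r k).powerset, patInd P r k S * hTab k S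

/-- AnchorDialSetTable helper `gS_mem` (decomp-qadv land package; see the module docstring). -/
theorem gS_mem {D : ℕ} {P : Fin N → CubeFn (ZMod 3) N} (hP : ∀ i, P i ∈ lowDeg (ZMod 3) N D) (r : ℕ)
    (k : Fin N) : gS P r k ∈ lowDeg (ZMod 3) N ((r + 1) * ((D + D) + 2) + r) := by
  unfold gS
  refine Submodule.sum_mem _ fun S hS => ?_
  rw [Finset.mem_powerset] at hS
  exact mul_mem_lowDeg_add (patInd_mem hP r k S) (hTab_mem r k S hS)

/-- AnchorDialSetTable helper `gS_apply` (decomp-qadv land package; see the module docstring). -/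
theorem gS_apply (P : Fin N → CubeFn (ZMod 3) N) (r : ℕ) (k : Fin N) (x : Fin N → Bool)
    (hdev : dev P x ⊆ winQ r k) :
    gS P r k x = thirdVal (dev P x) (fun q => wval x k.val (q.val - k.val)) := by
  unfold gS
  rw [Finset.sum_apply, Finset.sum_eq_single (dev P x)]
  · rw [Pi.mul_apply, patInd_apply_self P r k x, one_mul]
    rfl
  · intro S hS hne
    rw [Finset.mem_powerset] at hS
    rw [Pi.mul_apply, patInd_apply_ne P r k x S hS hdev hne, zero_mul]
  · intro h
    exact absurd (Finset.mem_powerset.2 hdev) h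

/-- **every window bet is a table certificate**: odd input, unique declared anchor `k`, deviation SET inside
`[k, k + r]` (any size): win ⟹ `CWT A (gS P r) x`. -/
theorem cwt_gS_of_rel (hN : 3 ≤ N) (P A : Fin N → CubeFn (ZMod 3) N) (r : ℕ) (x : Fin N → Bool)
    (hx : OddZeros x) (k : Fin N) (hk : anc A x = {k})
    (hdev : ∀ i ∈ dev P x, k.val ≤ i.val ∧ i.val ≤ k.val + r) (hrel : Rel x (outB P x)) :
    CWT A (gS P r) x := by
  have hsub : dev P x ⊆ winQ r k := fun q hq => by
    rw [winQ, mem_filter]; exact ⟨mem_univ _, hdev q hq⟩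
  rw [win_iff hN P x hx] at hrel
  have e : ((dev P x).filter fun q => gCond x q.val) = (dev P x).filter fun q =>
      ((cN x k.val : ℕ) : ZMod 3) ≠
        (if zpar x (k.val + 1) = true then 1 - wval x k.val (q.val - k.val)
          else wval x k.val (q.val - k.val)) := by
    refine filter_congr fun q hq => ?_
    obtain ⟨hkq, hqk⟩ := hdev q hq
    have hj : k.val + (q.val - k.val) = q.val := by omega
    have h := gCond_window x k.val (q.val - k.val) (by rw [hj]; exact q.isLt)
    rw [hj] at h
    exact h
  rw [e] at hrel
  refine ⟨k, hk, ?_⟩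
  rw [gS_apply P r k x hsub]
  revert hrel
  cases zpar x (k.val + 1) with
  | false =>
    intro hrel
    simp only [Bool.false_eq_true, if_false] at hrel ⊢
    exact ne_third_false (dev P x) (fun q => wval x k.val (q.val - k.val)) _ hrel
  | true =>
    intro hrel
    simp only [if_true] at hrel ⊢
    exact ne_third_true (dev P x) (fun q => wval x k.val (q.val - k.val)) _ hrel

/-- degree bookkeeping: `(r+1)·(2(log₂ n)^c + 2) + r ≤ (log₂ n)^(c+1)` once `n ≥ 2^{5r+6}`. -/
theorem deg_bump_set (n c r : ℕ) (hn : 2 ^ (5 * r + 6) ≤ n) :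
    (r + 1) * (((Nat.log 2 n) ^ c + (Nat.log 2 n) ^ c) + 2) + r ≤ (Nat.log 2 n) ^ (c + 1) := by
  have hL : 5 * r + 6 ≤ Nat.log 2 n := Nat.le_log_of_pow_le (by norm_num) hn
  have hpos : 1 ≤ (Nat.log 2 n) ^ c := Nat.one_le_pow _ _ (by omega)
  have h1 := Nat.mul_le_mul_left ((Nat.log 2 n) ^ c) hL
  have h2 := Nat.mul_le_mul_right r hpos
  rw [pow_succ]
  nlinarith [h1, h2, hpos]

end SetTable

end Summit.QuantumAdvantage.QuantumAdvantage.Theorems.AnchorDial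

end
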